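import Mathlib.Data.Nat.Choose.Basic
import Mathlib.Algebra.BigOperators.Group.Finset.Basic
import Mathlib.Tactic
import HarnessLib

/-!
# ζ(5) search — the inner sum of Brown–Zudilin's `Q_n`: two holonomic relations with certificates (cell `pub-zeta5`, P1)

HONEST FRAMING: systematic search; no irrationality claim unless certified.

Brown–Zudilin, arXiv:2210.03391, Sect. 2, eq. (7), define
`Q_n = Σ_{k ≤ n} C(n+k,n) C(n,k)² · T(n,k)`, `T(n,k) = Σ_{j ≤ n} C(n+j,n) C(n,j)² C(n+k+j,n)`.
This file proves, for the inner sum `T(n,k)` (`innerT`) with summand `t(n,k,j)` (`innerTerm`), two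
linear relations with polynomial coefficients, each by an explicit telescoping certificate in `j`
(found by the cell; `HOME/code/ct/step2c_verify.py` checks them on 12 090 integer points, here they are
PROVED for all `n, k`):

* (K) `relK`:  `-(k+n+1)³ T(n,k) + e₁(n,k) T(n,k+1) - (k-n+1)(k+n+2)² T(n,k+2) = 0`,
  `e₁ = 2k³+4k²n+8k²+kn²+9kn+11k-2n³-2n²+4n+5`, certificate `W_K(j) = n j³/(j+k+1) · t(n,k,j)`;
* (N) `relN`:  `(n+1)³ T(n+1,k) - 5(k+n+1)³ T(n,k) + (k-n)(5k²+15kn+15k+12n²+24n+12) T(n,k+1) = 0`,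
  certificate `W_N(j) = j³((8n+5k+8)j - (n+1)(7k+12n+12))/((j+n+1)(j+n+k+1)) · t(n+1,k,j)`.

So `T` is holonomic of rank two (basis `T(n,k), T(n,k+1)`); these relations feed the outer-sum
certificate (`SymmetricRecursionCert*.lean`) and the discharge of
`Literature.NumberTheory.Irrationality.BrownZudilin2022.Q_solvesRec` (`SymmetricFamilyRecursion.lean`).
The four cast identities `choose_*_cast` are the binomial ratio facts used throughout.
-/

namespace Summit.KontsevichZagierPeriods.Zeta5Search.SymmetricRecursion

open Finset

/-! ### Binomial ratio identities in `ℚ` (valid for all arguments) -/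

/-- `C(m+1,j)·(m+1-j) = C(m,j)·(m+1)` in `ℚ`, for all `m, j`. -/
theorem choose_succ_left_cast (m j : ℕ) :
    (((m + 1).choose j : ℕ) : ℚ) * ((m : ℚ) + 1 - j) = ((m.choose j : ℕ) : ℚ) * ((m : ℚ) + 1) := by
  rcases le_or_gt j (m + 1) with h | h
  · have e := Nat.choose_mul_succ_eq m j
    have e' : ((m.choose j : ℕ) : ℚ) * ((m : ℚ) + 1) = (((m + 1).choose j : ℕ) : ℚ) * (((m + 1 - j : ℕ)) : ℚ) := by
      exact_mod_cast e
    rw [e', Nat.cast_sub h]; push_cast; ring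
  · rw [Nat.choose_eq_zero_of_lt h, Nat.choose_eq_zero_of_lt (by omega : m < j)]; simp

/-- `C(m,j+1)·(j+1) = C(m,j)·(m-j)` in `ℚ`, for all `m, j`. -/
theorem choose_succ_right_cast (m j : ℕ) :
    ((m.choose (j + 1) : ℕ) : ℚ) * ((j : ℚ) + 1) = ((m.choose j : ℕ) : ℚ) * ((m : ℚ) - j) := by
  rcases le_or_gt j m with h | h
  · have e := Nat.choose_succ_right_eq m j
    have e' : ((m.choose (j + 1) : ℕ) : ℚ) * ((j : ℚ) + 1) = ((m.choose j : ℕ) : ℚ) * (((m - j : ℕ)) : ℚ) := by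
      exact_mod_cast e
    rw [e', Nat.cast_sub h]
  · rw [Nat.choose_eq_zero_of_lt h, Nat.choose_eq_zero_of_lt (by omega : m < j + 1)]; simp

/-- `C(m+1+j,m+1)·(m+1) = C(m+j,m)·(m+j+1)` in `ℚ`. -/
theorem choose_add_succ_left_cast (m j : ℕ) :
    (((m + 1 + j).choose (m + 1) : ℕ) : ℚ) * ((m : ℚ) + 1) = (((m + j).choose m : ℕ) : ℚ) * ((m : ℚ) + j + 1) := by
  have e := Nat.add_one_mul_choose_eq (m + j) m
  rw [show m + 1 + j = m + j + 1 by omega]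
  have e' : ((m : ℚ) + j + 1) * (((m + j).choose m : ℕ) : ℚ) = (((m + j + 1).choose (m + 1) : ℕ) : ℚ) * ((m : ℚ) + 1) := by
    exact_mod_cast e
  linarith [e']

/-- `C(m+j+1,m)·(j+1) = C(m+j,m)·(m+j+1)` in `ℚ`. -/
theorem choose_add_succ_right_cast (m j : ℕ) :
    (((m + (j + 1)).choose m : ℕ) : ℚ) * ((j : ℚ) + 1) = (((m + j).choose m : ℕ) : ℚ) * ((m : ℚ) + j + 1) := by
  have e := Nat.add_one_mul_choose_eq (m + j) j
  rw [show m + (j + 1) = m + j + 1 by omega]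
  have s1 : (m + j).choose m = (m + j).choose j := Nat.choose_symm_add
  have s2 : (m + j + 1).choose m = (m + j + 1).choose (j + 1) := by
    rw [show m + j + 1 = m + (j + 1) by omega]; exact Nat.choose_symm_add
  rw [s1, s2]
  have e' : ((m : ℚ) + j + 1) * (((m + j).choose j : ℕ) : ℚ) = (((m + j + 1).choose (j + 1) : ℕ) : ℚ) * ((j : ℚ) + 1) := by
    exact_mod_cast e
  linarith [e']

/-! ### The inner summand and sum -/

/-- The inner summand `t(n,k,j) = C(n,j)² C(n+j,n) C(n+k+j,n)` of Brown–Zudilin (7), as a rational. -/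
def innerTerm (n k j : ℕ) : ℚ :=
  ((n.choose j : ℕ) : ℚ) ^ 2 * (((n + j).choose n : ℕ) : ℚ) * (((n + k + j).choose n : ℕ) : ℚ)

/-- The inner sum `T(n,k) = Σ_{j ≤ n} C(n,j)² C(n+j,n) C(n+k+j,n)` of Brown–Zudilin (7). -/
def innerT (n k : ℕ) : ℚ := ∑ j ∈ range (n + 1), innerTerm n k j

/-- `t(n,k,n+1) = 0`. -/
theorem innerTerm_succ_self (n k : ℕ) : innerTerm n k (n + 1) = 0 := by
  simp [innerTerm, Nat.choose_succ_self]

/-- The sum may be extended by one vanishing term: `T(n,k) = Σ_{j ≤ n+1} t(n,k,j)`. -/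
theorem innerT_eq_sum_succ (n k : ℕ) : innerT n k = ∑ j ∈ range (n + 2), innerTerm n k j := by
  rw [innerT, Finset.sum_range_succ _ (n + 1), innerTerm_succ_self, add_zero]

/-! ### Ratio identities of the summand -/

/-- Shift in `k`: `t(n,k+1,j)·(k+j+1) = t(n,k,j)·(n+k+j+1)`. -/
theorem innerTerm_k_succ (n k j : ℕ) :
    innerTerm n (k + 1) j * ((k : ℚ) + j + 1) = innerTerm n k j * ((n : ℚ) + k + j + 1) := by
  have h := choose_add_succ_right_cast n (k + j)
  rw [show n + (k + j + 1) = n + (k + 1) + j by omega, show n + (k + j) = n + k + j by omega] at h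
  unfold innerTerm
  push_cast at h ⊢
  linear_combination ((n.choose j : ℕ) : ℚ) ^ 2 * (((n + j).choose n : ℕ) : ℚ) * h

/-- Shift in `j`: `t(n,k,j+1)·(j+1)³(k+j+1) = t(n,k,j)·(n-j)²(n+j+1)(n+k+j+1)`. -/
theorem innerTerm_j_succ (n k j : ℕ) :
    innerTerm n k (j + 1) * (((j : ℚ) + 1) ^ 3 * ((k : ℚ) + j + 1))
      = innerTerm n k j * (((n : ℚ) - j) ^ 2 * ((n : ℚ) + j + 1) * ((n : ℚ) + k + j + 1)) := by
  have h1 := choose_succ_right_cast n j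
  have h2 := choose_add_succ_right_cast n j
  have h3 := choose_add_succ_right_cast n (k + j)
  rw [show n + (k + j + 1) = n + k + (j + 1) by omega, show n + (k + j) = n + k + j by omega] at h3
  unfold innerTerm
  push_cast at h1 h2 h3 ⊢
  set a := ((n.choose (j + 1) : ℕ) : ℚ)
  set b := ((n.choose j : ℕ) : ℚ)
  set c := (((n + (j + 1)).choose n : ℕ) : ℚ)
  set d := (((n + j).choose n : ℕ) : ℚ)
  set e := (((n + k + (j + 1)).choose n : ℕ) : ℚ)
  set f := (((n + k + j).choose n : ℕ) : ℚ)
  have ha : a * ((j : ℚ) + 1) = b * ((n : ℚ) - j) := h1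
  have hc : c * ((j : ℚ) + 1) = d * ((n : ℚ) + j + 1) := h2
  have he : e * ((k : ℚ) + j + 1) = f * ((n : ℚ) + ((k : ℚ) + j) + 1) := h3
  calc a ^ 2 * c * e * (((j : ℚ) + 1) ^ 3 * ((k : ℚ) + j + 1))
      = (a * ((j : ℚ) + 1)) ^ 2 * (c * ((j : ℚ) + 1)) * (e * ((k : ℚ) + j + 1)) := by ring
    _ = (b * ((n : ℚ) - j)) ^ 2 * (d * ((n : ℚ) + j + 1)) * (f * ((n : ℚ) + ((k : ℚ) + j) + 1)) := by
        rw [ha, hc, he]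
    _ = b ^ 2 * d * f * (((n : ℚ) - j) ^ 2 * ((n : ℚ) + j + 1) * ((n : ℚ) + k + j + 1)) := by ring

/-- Shift in `n`: `t(n,k,j)·(n+1)²(n+j+1)(n+k+j+1) = t(n+1,k,j)·(n+1-j)²(n+1)²`. -/
theorem innerTerm_n_succ (n k j : ℕ) :
    innerTerm n k j * (((n : ℚ) + 1) ^ 2 * ((n : ℚ) + j + 1) * ((n : ℚ) + k + j + 1))
      = innerTerm (n + 1) k j * (((n : ℚ) + 1 - j) ^ 2 * ((n : ℚ) + 1) ^ 2) := by
  have h1 := choose_succ_left_cast n j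
  have h2 := choose_add_succ_left_cast n j
  have h3 := choose_add_succ_left_cast n (k + j)
  rw [show n + 1 + (k + j) = n + 1 + k + j by omega, show n + (k + j) = n + k + j by omega] at h3
  unfold innerTerm
  push_cast at h1 h2 h3 ⊢
  set a := (((n + 1).choose j : ℕ) : ℚ)
  set b := ((n.choose j : ℕ) : ℚ)
  set c := (((n + 1 + j).choose (n + 1) : ℕ) : ℚ)
  set d := (((n + j).choose n : ℕ) : ℚ)
  set e := (((n + 1 + k + j).choose (n + 1) : ℕ) : ℚ)
  set f := (((n + k + j).choose n : ℕ) : ℚ)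
  have ha : a * ((n : ℚ) + 1 - j) = b * ((n : ℚ) + 1) := h1
  have hc : c * ((n : ℚ) + 1) = d * ((n : ℚ) + j + 1) := h2
  have he : e * ((n : ℚ) + 1) = f * ((n : ℚ) + ((k : ℚ) + j) + 1) := h3
  calc b ^ 2 * d * f * (((n : ℚ) + 1) ^ 2 * ((n : ℚ) + j + 1) * ((n : ℚ) + k + j + 1))
      = (b * ((n : ℚ) + 1)) ^ 2 * (d * ((n : ℚ) + j + 1)) * (f * ((n : ℚ) + k + j + 1)) := by ring
    _ = (b * ((n : ℚ) + 1)) ^ 2 * (d * ((n : ℚ) + j + 1)) * (f * ((n : ℚ) + ((k : ℚ) + j) + 1)) := by ring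
    _ = (a * ((n : ℚ) + 1 - j)) ^ 2 * (c * ((n : ℚ) + 1)) * (e * ((n : ℚ) + 1)) := by rw [ha, hc, he]
    _ = a ^ 2 * c * e * (((n : ℚ) + 1 - j) ^ 2 * ((n : ℚ) + 1) ^ 2) := by ring

/-! ### Relation (K): the second-order recurrence in `k` -/

/-- The polynomial `e₁(n,k) = 2k³+4k²n+8k²+kn²+9kn+11k-2n³-2n²+4n+5` (middle coefficient of (K)). -/
def e₁ (n k : ℚ) : ℚ :=
  2 * k ^ 3 + 4 * k ^ 2 * n + 8 * k ^ 2 + k * n ^ 2 + 9 * k * n + 11 * k - 2 * n ^ 3 - 2 * n ^ 2 + 4 * n + 5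

/-- Certificate of (K): `W_K(j) = n j³/(j+k+1) · t(n,k,j)`. -/
def certK (n k j : ℕ) : ℚ := (n : ℚ) * (j : ℚ) ^ 3 / ((j : ℚ) + k + 1) * innerTerm n k j

/-- Termwise form of (K): the combination of `t(n,k,j), t(n,k+1,j), t(n,k+2,j)` telescopes in `j`. -/
theorem relK_term (n k j : ℕ) :
    -((k : ℚ) + n + 1) ^ 3 * innerTerm n k j + e₁ n k * innerTerm n (k + 1) j
        - ((k : ℚ) - n + 1) * ((k : ℚ) + n + 2) ^ 2 * innerTerm n (k + 2) j
      = certK n k (j + 1) - certK n k j := by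
  have hk1 : ((k : ℚ) + j + 1) ≠ 0 := by positivity
  have hk2 : ((k : ℚ) + 1 + j + 1) ≠ 0 := by positivity
  have hj1 : (((j : ℚ) + 1) ^ 3 * ((k : ℚ) + j + 1)) ≠ 0 := by positivity
  have r1 : innerTerm n (k + 1) j = innerTerm n k j * (((n : ℚ) + k + j + 1) / ((k : ℚ) + j + 1)) := by
    rw [mul_div_assoc', eq_div_iff hk1]; exact innerTerm_k_succ n k j
  have r2 : innerTerm n (k + 2) j = innerTerm n (k + 1) j * (((n : ℚ) + (k + 1 : ℕ) + j + 1) / ((k : ℚ) + 1 + j + 1)) := by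
    rw [mul_div_assoc', eq_div_iff hk2]
    have := innerTerm_k_succ n (k + 1) j
    push_cast at this ⊢
    exact this
  have r3 : innerTerm n k (j + 1) = innerTerm n k j *
      ((((n : ℚ) - j) ^ 2 * ((n : ℚ) + j + 1) * ((n : ℚ) + k + j + 1)) / (((j : ℚ) + 1) ^ 3 * ((k : ℚ) + j + 1))) := by
    rw [mul_div_assoc', eq_div_iff hj1]; exact innerTerm_j_succ n k j
  unfold certK e₁
  rw [r2, r1, r3]
  push_cast
  have hd1 : ((j : ℚ) + k + 1) ≠ 0 := by positivity
  have hd2 : (((j + 1 : ℕ) : ℚ) + k + 1) ≠ 0 := by positivity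
  push_cast at hd2
  field_simp
  ring

/-- **Relation (K)** for the inner sum: `-(k+n+1)³ T(n,k) + e₁ T(n,k+1) - (k-n+1)(k+n+2)² T(n,k+2) = 0`. -/
theorem relK (n k : ℕ) :
    -((k : ℚ) + n + 1) ^ 3 * innerT n k + e₁ n k * innerT n (k + 1)
        - ((k : ℚ) - n + 1) * ((k : ℚ) + n + 2) ^ 2 * innerT n (k + 2) = 0 := by
  have hsum : -((k : ℚ) + n + 1) ^ 3 * innerT n k + e₁ n k * innerT n (k + 1)
        - ((k : ℚ) - n + 1) * ((k : ℚ) + n + 2) ^ 2 * innerT n (k + 2)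
      = ∑ j ∈ range (n + 1), (certK n k (j + 1) - certK n k j) := by
    unfold innerT
    rw [Finset.mul_sum, Finset.mul_sum, Finset.mul_sum, ← Finset.sum_add_distrib, ← Finset.sum_sub_distrib]
    exact Finset.sum_congr rfl fun j _ => relK_term n k j
  rw [hsum, Finset.sum_range_sub, certK, certK, innerTerm_succ_self]
  simp

/-! ### Relation (N): the mixed first-order relation -/

/-- The polynomial `q(n,k) = 5k²+15kn+15k+12n²+24n+12` (in the last coefficient of (N)). -/
def qN (n k : ℚ) : ℚ := 5 * k ^ 2 + 15 * k * n + 15 * k + 12 * n ^ 2 + 24 * n + 12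

/-- Certificate of (N): `W_N(j) = j³((8n+5k+8)j - (n+1)(7k+12n+12))/((j+n+1)(j+n+k+1)) · t(n+1,k,j)`. -/
def certN (n k j : ℕ) : ℚ :=
  (j : ℚ) ^ 3 * ((8 * (n : ℚ) + 5 * k + 8) * j - ((n : ℚ) + 1) * (7 * (k : ℚ) + 12 * n + 12))
    / (((j : ℚ) + n + 1) * ((j : ℚ) + n + k + 1)) * innerTerm (n + 1) k j

/-- Termwise form of (N): the combination of `t(n+1,k,j), t(n,k,j), t(n,k+1,j)` telescopes in `j`. -/
theorem relN_term (n k j : ℕ) :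
    ((n : ℚ) + 1) ^ 3 * innerTerm (n + 1) k j - 5 * ((k : ℚ) + n + 1) ^ 3 * innerTerm n k j
        + ((k : ℚ) - n) * qN n k * innerTerm n (k + 1) j
      = certN n k (j + 1) - certN n k j := by
  have hk1 : ((k : ℚ) + j + 1) ≠ 0 := by positivity
  have hn1 : (((n : ℚ) + 1) ^ 2 * ((n : ℚ) + j + 1) * ((n : ℚ) + k + j + 1)) ≠ 0 := by positivity
  have hj1 : (((j : ℚ) + 1) ^ 3 * ((k : ℚ) + j + 1)) ≠ 0 := by positivity
  have r1 : innerTerm n (k + 1) j = innerTerm n k j * (((n : ℚ) + k + j + 1) / ((k : ℚ) + j + 1)) := by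
    rw [mul_div_assoc', eq_div_iff hk1]; exact innerTerm_k_succ n k j
  have r0 : innerTerm n k j = innerTerm (n + 1) k j *
      ((((n : ℚ) + 1 - j) ^ 2 * ((n : ℚ) + 1) ^ 2) / (((n : ℚ) + 1) ^ 2 * ((n : ℚ) + j + 1) * ((n : ℚ) + k + j + 1))) := by
    rw [mul_div_assoc', eq_div_iff hn1]; exact innerTerm_n_succ n k j
  have r3 : innerTerm (n + 1) k (j + 1) = innerTerm (n + 1) k j *
      (((((n + 1 : ℕ) : ℚ) - j) ^ 2 * (((n + 1 : ℕ) : ℚ) + j + 1) * (((n + 1 : ℕ) : ℚ) + k + j + 1))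
        / (((j : ℚ) + 1) ^ 3 * ((k : ℚ) + j + 1))) := by
    rw [mul_div_assoc', eq_div_iff hj1]; exact innerTerm_j_succ (n + 1) k j
  unfold certN qN
  rw [r1, r0, r3]
  push_cast
  have hd1 : ((j : ℚ) + n + 1) * ((j : ℚ) + n + k + 1) ≠ 0 := by positivity
  have hd2 : (((j + 1 : ℕ) : ℚ) + n + 1) * (((j + 1 : ℕ) : ℚ) + n + k + 1) ≠ 0 := by positivity
  push_cast at hd2
  have hd3 : ((n : ℚ) + 1) ≠ 0 := by positivity
  have hd4 : ((n : ℚ) + j + 1) ≠ 0 := by positivity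
  have hd5 : ((n : ℚ) + k + j + 1) ≠ 0 := by positivity
  have hd6 : ((j : ℚ) + 1) ≠ 0 := by positivity
  field_simp
  ring

/-- **Relation (N)** for the inner sum:
`(n+1)³ T(n+1,k) - 5(k+n+1)³ T(n,k) + (k-n) q(n,k) T(n,k+1) = 0`. -/
theorem relN (n k : ℕ) :
    ((n : ℚ) + 1) ^ 3 * innerT (n + 1) k - 5 * ((k : ℚ) + n + 1) ^ 3 * innerT n k
        + ((k : ℚ) - n) * qN n k * innerT n (k + 1) = 0 := by
  have hsum : ((n : ℚ) + 1) ^ 3 * innerT (n + 1) k - 5 * ((k : ℚ) + n + 1) ^ 3 * innerT n k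
        + ((k : ℚ) - n) * qN n k * innerT n (k + 1)
      = ∑ j ∈ range (n + 2), (certN n k (j + 1) - certN n k j) := by
    rw [innerT_eq_sum_succ n k, innerT_eq_sum_succ n (k + 1), innerT]
    rw [Finset.mul_sum, Finset.mul_sum, Finset.mul_sum, ← Finset.sum_sub_distrib, ← Finset.sum_add_distrib]
    exact Finset.sum_congr rfl fun j _ => relN_term n k j
  rw [hsum, Finset.sum_range_sub, certN, certN]
  have : innerTerm (n + 1) k (n + 2) = 0 := by
    simp [innerTerm]
  rw [this]
  simp

end Summit.KontsevichZagierPeriods.Zeta5Search.SymmetricRecursion
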